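import Summits.CriticalPhenomena.PercolationContinuityZ3.Theses.PercVarianceSandwich
import Literature.Probability.Percolation.DeletionTolerance
import Literature.Probability.Percolation.StaticRenormalizationBoxes
import Literature.Probability.Percolation.SharpnessDCTProofs
import Literature.Probability.Percolation.CriticalContinuityProofs
import HarnessLib

/-!
# `PercVarianceSandwich.PinholeToPolynomialBlocking` (stmt-CriticalPhenomena-6071), settled:
# pinhole blocking with `k` edges forces annulus blocking of probability `≥ c'/n^{6k}` (finite energy + union bound)

RSW3 lane (cell `prim-rsw3`, prover P2, gen 31).  Closes the support item AS FILED.  Nothing here uses p205010.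
If at `p_c(ℤ³)` the annulus `B(2n) ∖ B(n)` can be blocked (no open path inside `B(2n)` from `B(n)` to
`∂ⁱⁿB(2n)`) by CLOSING at most `k` edges, with probability `≥ c` for every `n ≥ 1`, then the annulus is
already blocked with probability `≥ c (1-p_c)^k / ((k+1)(6n)^{6k})`; hence blocking is not superpolynomially
small: with exponent `6k+1`, for every `K` some `n ≥ 1` has `K/n^{6k+1} < P_{p_c}(blocked)`.

* `blocking_determinedBy` — the blocking event is determined by the pairs of `B(2n)`;
* `pinhole_subset` — the pinhole event is covered by the `≤ (k+1)|B(2n)^{(2)}|^k` events "closing the pairs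
  of `S ⊆ B(2n)^{(2)}`, `|S| ≤ k`, blocks" (edges off `B(2n)` are irrelevant);
* `real_blocking_ge` — deletion tolerance (`bondPercolation_pow_mul_real_preimage_closeEdges_le`:
  `(1-p)^{|S|} P(ω ∖ S ∈ E) ≤ P(E)`) and the union bound give `P(E) ≥ c(1-p_c)^k/((k+1)(6n)^{6k})`;
* `pinholeToPolynomialBlocking_proof` — the route decl.

References: G. Grimmett, *Percolation* (1999), §1.3 (product measure / finite energy), §2.2 (events
determined by finitely many edges); C. Newman, V. Tassion, W. Wu (2017) (pinhole/pivotal language).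
-/

noncomputable section

namespace Summit.CriticalPhenomena.PercolationContinuityZ3.Theorems.PinholeBlocking

open MeasureTheory Literature.Probability.Percolation Literature.Probability.LatticeModels

/-- The blocking event is determined by the pairs inside `B(2n)`. -/
theorem blocking_determinedBy (n : ℕ) :
    DeterminedBy ({ω : BondConfig (Site 3) | ¬ ∃ x ∈ box 3 n, ∃ y ∈ innerBoundary (zdGraph 3) (box 3 (2 * n)), ω ∈ openConnIn ↑(box 3 (2 * n)) x y}) (↑(box 3 (2 * n)).sym2 : Set (Sym2 (Site 3))) := by
  have h : DeterminedBy (⋃ x ∈ (↑(box 3 n) : Set (Site 3)), ⋃ y ∈ (↑(innerBoundary (zdGraph 3) (box 3 (2 * n))) : Set (Site 3)),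
      openConnIn (↑(box 3 (2 * n)) : Set (Site 3)) x y) (↑(box 3 (2 * n)).sym2 : Set (Sym2 (Site 3))) := by
    refine DeterminedBy.iUnion₂ fun x _ => DeterminedBy.iUnion₂ fun y _ => ?_
    exact DCT16.determinedBy_openConnIn _ x y (by rw [Finset.coe_sym2])
  have heq : {ω : BondConfig (Site 3) | ¬ ∃ x ∈ box 3 n, ∃ y ∈ innerBoundary (zdGraph 3) (box 3 (2 * n)), ω ∈ openConnIn ↑(box 3 (2 * n)) x y} = (⋃ x ∈ (↑(box 3 n) : Set (Site 3)), ⋃ y ∈ (↑(innerBoundary (zdGraph 3) (box 3 (2 * n))) : Set (Site 3)),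
      openConnIn (↑(box 3 (2 * n)) : Set (Site 3)) x y)ᶜ := by
    ext ω
    simp only [Set.mem_setOf_eq, Set.mem_compl_iff, Set.mem_iUnion, Finset.mem_coe, exists_prop]
  rw [heq]
  exact h.compl'

/-- The blocking event is measurable. -/
theorem measurableSet_blocking (n : ℕ) : MeasurableSet ({ω : BondConfig (Site 3) | ¬ ∃ x ∈ box 3 n, ∃ y ∈ innerBoundary (zdGraph 3) (box 3 (2 * n)), ω ∈ openConnIn ↑(box 3 (2 * n)) x y}) :=
  (blocking_determinedBy n).measurableSet_of_finset

/-- **Pinholes inside the box suffice**: if closing a finite `S` with `|S| ≤ k` blocks the annulus, then so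
does closing `S ∩ B(2n)^{(2)}`, a member of `⋃_{j ≤ k} powersetCard j (B(2n)^{(2)})`. -/
theorem pinhole_subset (n k : ℕ) :
    {ω : BondConfig (Site 3) | ∃ S : Finset (Sym2 (Site 3)), S.card ≤ k ∧ ω \ ↑S ∈ {ω : BondConfig (Site 3) | ¬ ∃ x ∈ box 3 n, ∃ y ∈ innerBoundary (zdGraph 3) (box 3 (2 * n)), ω ∈ openConnIn ↑(box 3 (2 * n)) x y}} ⊆
      ⋃ j ∈ Finset.range (k + 1), ⋃ S' ∈ ((box 3 (2 * n)).sym2).powersetCard j,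
        closeEdges (↑S' : Set (Sym2 (Site 3))) ⁻¹' {ω : BondConfig (Site 3) | ¬ ∃ x ∈ box 3 n, ∃ y ∈ innerBoundary (zdGraph 3) (box 3 (2 * n)), ω ∈ openConnIn ↑(box 3 (2 * n)) x y} := by
  classical
  rintro ω ⟨S, hSk, hSE⟩
  set T := (box 3 (2 * n)).sym2 with hT
  set S' := S ∩ T with hS'
  simp only [Set.mem_iUnion, Finset.mem_range, exists_prop]
  refine ⟨S'.card, ?_, S', Finset.mem_powersetCard.2 ⟨Finset.inter_subset_right, rfl⟩, ?_⟩
  · exact Nat.lt_succ_of_le ((Finset.card_le_card Finset.inter_subset_left).trans hSk)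
  · -- `ω ∖ S'` and `ω ∖ S` agree on the pairs of `B(2n)`
    rw [Set.mem_preimage, closeEdges_eq]
    have hagree : (ω \ ↑S') ∩ (↑T : Set (Sym2 (Site 3))) = (ω \ ↑S) ∩ ↑T := by
      ext e
      simp only [Set.mem_inter_iff, Set.mem_sdiff, Finset.mem_coe, hS', Finset.mem_inter]
      tauto
    exact ((determinedBy_iff _ _).1 (blocking_determinedBy n) _ _ hagree).2 hSE

/-- Cardinality of `B(2n)^{(2)}`: at most `(6n)^6` for `n ≥ 1` (`|B(2n)| = (4n+1)^3`). -/
theorem card_sym2_box_le {n : ℕ} (hn : 1 ≤ n) : ((box 3 (2 * n)).sym2).card ≤ (6 * n) ^ 6 := by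
  rw [Finset.card_sym2, card_box]
  have h1 : (2 * (2 * n) + 1) ^ 3 + 1 ≤ (6 * n) ^ 3 := by
    have h5 : 2 * (2 * n) + 1 ≤ 5 * n := by omega
    have h5' : (2 * (2 * n) + 1) ^ 3 ≤ (5 * n) ^ 3 := Nat.pow_le_pow_left h5 3
    have hn3 : 1 ≤ n ^ 3 := Nat.one_le_pow _ _ hn
    have e5 : (5 * n) ^ 3 = 125 * n ^ 3 := by ring
    have e6 : (6 * n) ^ 3 = 216 * n ^ 3 := by ring
    rw [e6]; rw [e5] at h5'
    linarith
  calc ((2 * (2 * n) + 1) ^ 3 + 1).choose 2 ≤ ((2 * (2 * n) + 1) ^ 3 + 1) ^ 2 := Nat.choose_le_pow _ _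
    _ ≤ ((6 * n) ^ 3) ^ 2 := Nat.pow_le_pow_left h1 2
    _ = (6 * n) ^ 6 := by ring

/-- **The lower bound on blocking from pinhole blocking**: if with probability `≥ c` some `≤ k` closed
edges block the annulus, then `P_p(blocked) ≥ c (1-p)^k / ((k+1)(6n)^{6k})` (`n ≥ 1`, any `p`). -/
theorem real_blocking_ge (p : unitInterval) {n k : ℕ} (hn : 1 ≤ n) {c : ℝ}
    (hpin : c ≤ (bondPercolation (zdGraph 3) p).real
      {ω : BondConfig (Site 3) | ∃ S : Finset (Sym2 (Site 3)), S.card ≤ k ∧ ω \ ↑S ∈ {ω : BondConfig (Site 3) | ¬ ∃ x ∈ box 3 n, ∃ y ∈ innerBoundary (zdGraph 3) (box 3 (2 * n)), ω ∈ openConnIn ↑(box 3 (2 * n)) x y}}) :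
    c * (1 - (p : ℝ)) ^ k ≤ ((k : ℝ) + 1) * ((6 * (n : ℝ)) ^ 6) ^ k * (bondPercolation (zdGraph 3) p).real ({ω : BondConfig (Site 3) | ¬ ∃ x ∈ box 3 n, ∃ y ∈ innerBoundary (zdGraph 3) (box 3 (2 * n)), ω ∈ openConnIn ↑(box 3 (2 * n)) x y}) := by
  classical
  set μ := bondPercolation (zdGraph 3) p with hμ
  set T := (box 3 (2 * n)).sym2 with hT
  set E := {ω : BondConfig (Site 3) | ¬ ∃ x ∈ box 3 n, ∃ y ∈ innerBoundary (zdGraph 3) (box 3 (2 * n)), ω ∈ openConnIn ↑(box 3 (2 * n)) x y} with hE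
  have hq0 : 0 ≤ 1 - (p : ℝ) := by linarith [p.2.2]
  have hq1 : 1 - (p : ℝ) ≤ 1 := by linarith [p.2.1]
  have hEm : MeasurableSet E := measurableSet_blocking n
  -- each term: `(1-p)^k P(closeEdges S' ⁻¹' E) ≤ P(E)` for `|S'| = j ≤ k`
  have hterm : ∀ j ∈ Finset.range (k + 1), ∀ S' ∈ T.powersetCard j,
      (1 - (p : ℝ)) ^ k * μ.real (closeEdges (↑S' : Set (Sym2 (Site 3))) ⁻¹' E) ≤ μ.real E := by
    intro j hj S' hS'
    have hcard : S'.card = j := (Finset.mem_powersetCard.1 hS').2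
    have hjk : j ≤ k := Nat.lt_succ_iff.1 (Finset.mem_range.1 hj)
    have hpow : (1 - (p : ℝ)) ^ k ≤ (1 - (p : ℝ)) ^ S'.card := by
      rw [hcard]; exact pow_le_pow_of_le_one hq0 hq1 hjk
    calc (1 - (p : ℝ)) ^ k * μ.real (closeEdges (↑S' : Set (Sym2 (Site 3))) ⁻¹' E)
        ≤ (1 - (p : ℝ)) ^ S'.card * μ.real (closeEdges (↑S' : Set (Sym2 (Site 3))) ⁻¹' E) :=
          mul_le_mul_of_nonneg_right hpow measureReal_nonneg
      _ ≤ μ.real E := bondPercolation_pow_mul_real_preimage_closeEdges_le (zdGraph 3) p S' hEm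
  -- the count
  have hTcard : (T.card : ℝ) ≤ (6 * (n : ℝ)) ^ 6 := by exact_mod_cast card_sym2_box_le hn
  have hcount : ∀ j ∈ Finset.range (k + 1), ((T.powersetCard j).card : ℝ) ≤ ((6 * (n : ℝ)) ^ 6) ^ k := by
    intro j hj
    have hjk : j ≤ k := Nat.lt_succ_iff.1 (Finset.mem_range.1 hj)
    rw [Finset.card_powersetCard]
    have h1 : (T.card.choose j : ℝ) ≤ (T.card : ℝ) ^ j := by exact_mod_cast Nat.choose_le_pow _ _
    have h2 : (T.card : ℝ) ^ j ≤ ((6 * (n : ℝ)) ^ 6) ^ j := pow_le_pow_left₀ (Nat.cast_nonneg _) hTcard j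
    have h3 : ((6 * (n : ℝ)) ^ 6) ^ j ≤ ((6 * (n : ℝ)) ^ 6) ^ k := by
      refine pow_le_pow_right₀ ?_ hjk
      have hn' : (1 : ℝ) ≤ n := by exact_mod_cast hn
      have h6 : (1 : ℝ) ≤ 6 * (n : ℝ) := by linarith
      exact one_le_pow₀ h6
    linarith
  -- the union bound
  calc c * (1 - (p : ℝ)) ^ k ≤ μ.real {ω | ∃ S : Finset (Sym2 (Site 3)), S.card ≤ k ∧ ω \ ↑S ∈ E} * (1 - (p : ℝ)) ^ k :=
        mul_le_mul_of_nonneg_right hpin (pow_nonneg hq0 k)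
    _ ≤ μ.real (⋃ j ∈ Finset.range (k + 1), ⋃ S' ∈ T.powersetCard j,
          closeEdges (↑S' : Set (Sym2 (Site 3))) ⁻¹' E) * (1 - (p : ℝ)) ^ k :=
        mul_le_mul_of_nonneg_right (measureReal_mono (pinhole_subset n k) (measure_ne_top _ _)) (pow_nonneg hq0 k)
    _ ≤ (∑ j ∈ Finset.range (k + 1), μ.real (⋃ S' ∈ T.powersetCard j,
          closeEdges (↑S' : Set (Sym2 (Site 3))) ⁻¹' E)) * (1 - (p : ℝ)) ^ k :=
        mul_le_mul_of_nonneg_right (measureReal_biUnion_finset_le _ _) (pow_nonneg hq0 k)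
    _ ≤ (∑ j ∈ Finset.range (k + 1), ∑ S' ∈ T.powersetCard j,
          μ.real (closeEdges (↑S' : Set (Sym2 (Site 3))) ⁻¹' E)) * (1 - (p : ℝ)) ^ k :=
        mul_le_mul_of_nonneg_right (Finset.sum_le_sum fun j _ => measureReal_biUnion_finset_le _ _) (pow_nonneg hq0 k)
    _ = ∑ j ∈ Finset.range (k + 1), ∑ S' ∈ T.powersetCard j,
          (1 - (p : ℝ)) ^ k * μ.real (closeEdges (↑S' : Set (Sym2 (Site 3))) ⁻¹' E) := by
        rw [Finset.sum_mul]; refine Finset.sum_congr rfl fun j _ => ?_; rw [Finset.sum_mul]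
        exact Finset.sum_congr rfl fun S' _ => by ring
    _ ≤ ∑ j ∈ Finset.range (k + 1), ∑ _S' ∈ T.powersetCard j, μ.real E :=
        Finset.sum_le_sum fun j hj => Finset.sum_le_sum fun S' hS' => hterm j hj S' hS'
    _ = ∑ j ∈ Finset.range (k + 1), ((T.powersetCard j).card : ℝ) * μ.real E := by
        refine Finset.sum_congr rfl fun j _ => ?_; rw [Finset.sum_const, nsmul_eq_mul]
    _ ≤ ∑ _j ∈ Finset.range (k + 1), ((6 * (n : ℝ)) ^ 6) ^ k * μ.real E :=
        Finset.sum_le_sum fun j hj => mul_le_mul_of_nonneg_right (hcount j hj) measureReal_nonneg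
    _ = ((k : ℝ) + 1) * ((6 * (n : ℝ)) ^ 6) ^ k * μ.real E := by
        rw [Finset.sum_const, Finset.card_range, nsmul_eq_mul]; push_cast; ring

/-- **`PercVarianceSandwich.PinholeToPolynomialBlocking` (stmt-CriticalPhenomena-6071), settled.**  If at
`p_c(ℤ³)` the annulus `B(2n) ∖ B(n)` is blocked after closing at most `k` edges with probability `≥ c > 0`
for every `n ≥ 1`, then with the exponent `6k+1`: for every `K` some `n ≥ 1` has
`K/n^{6k+1} < P_{p_c}(the annulus is blocked)` — indeed `P_{p_c}(blocked) ≥ c(1-p_c)^k/((k+1)(6^6)^k) · n^{-6k}`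
for all `n ≥ 1` (`real_blocking_ge`, finite energy for closing edges and a union bound over the
`≤ (k+1)(6n)^{6k}` candidate pinhole sets inside `B(2n)`), and `p_c(ℤ³) < 1` (`criticalProb_zd_lt_one`). -/
theorem pinholeToPolynomialBlocking_proof :
    Summit.CriticalPhenomena.PercolationContinuityZ3.Theses.PercVarianceSandwich.PinholeToPolynomialBlocking := by
  rintro ⟨k, c, hc, hpin⟩
  refine ⟨6 * k + 1, fun K => ?_⟩
  set p := criticalProbI 3 with hp
  have hp1 : (p : ℝ) < 1 := by rw [hp, coe_criticalProbI]; exact criticalProb_zd_lt_one (by norm_num)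
  set q : ℝ := 1 - (p : ℝ) with hq
  have hq0 : 0 < q := by rw [hq]; linarith
  -- the constant of the polynomial lower bound
  set c' : ℝ := c * q ^ k / (((k : ℝ) + 1) * ((6 : ℝ) ^ 6) ^ k) with hc'
  have hc'0 : 0 < c' := by rw [hc']; positivity
  -- choose `n > K / c'`, `n ≥ 1`
  obtain ⟨n, hn⟩ := exists_nat_gt (max (K / c') 1)
  have hn1 : 1 ≤ n := by
    have : (1 : ℝ) < n := lt_of_le_of_lt (le_max_right _ _) hn
    exact_mod_cast this.le
  have hnK : K / c' < n := lt_of_le_of_lt (le_max_left _ _) hn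
  have hn0 : (0 : ℝ) < n := by exact_mod_cast hn1
  refine ⟨n, hn1, ?_⟩
  have hmain := real_blocking_ge p hn1 (hpin n hn1)
  -- `P(blocked) ≥ c'/n^{6k}`
  have hden : 0 < ((k : ℝ) + 1) * ((6 * (n : ℝ)) ^ 6) ^ k := by positivity
  have hP : c' / (n : ℝ) ^ (6 * k) ≤ (bondPercolation (zdGraph 3) p).real ({ω : BondConfig (Site 3) | ¬ ∃ x ∈ box 3 n, ∃ y ∈ innerBoundary (zdGraph 3) (box 3 (2 * n)), ω ∈ openConnIn ↑(box 3 (2 * n)) x y}) := by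
    have h1 : c * q ^ k / (((k : ℝ) + 1) * ((6 * (n : ℝ)) ^ 6) ^ k) ≤
        (bondPercolation (zdGraph 3) p).real ({ω : BondConfig (Site 3) | ¬ ∃ x ∈ box 3 n, ∃ y ∈ innerBoundary (zdGraph 3) (box 3 (2 * n)), ω ∈ openConnIn ↑(box 3 (2 * n)) x y}) := by
      rw [div_le_iff₀ hden]; linarith
    have h2 : c' / (n : ℝ) ^ (6 * k) = c * q ^ k / (((k : ℝ) + 1) * ((6 * (n : ℝ)) ^ 6) ^ k) := by
      rw [hc']
      field_simp
      ring
    rw [h2]; exact h1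
  -- `K / n^{6k+1} < c' / n^{6k}`
  have hlt : K / (n : ℝ) ^ (6 * k + 1) < c' / (n : ℝ) ^ (6 * k) := by
    have hK : K < c' * n := by rw [div_lt_iff₀ hc'0] at hnK; linarith
    rw [pow_succ, div_lt_div_iff₀ (by positivity) (by positivity)]
    have hpos : (0 : ℝ) < (n : ℝ) ^ (6 * k) := by positivity
    nlinarith
  exact lt_of_lt_of_le hlt hP

end Summit.CriticalPhenomena.PercolationContinuityZ3.Theorems.PinholeBlocking
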